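import Summits.QuantumFields.QCD.Theorems.QuarksAsStableActionStableActionBridgeStubTorusDenominatorsSpectral
import Summits.QuantumFields.QCD.Theorems.QuarksAsStableActionStableActionBridgeStubThermalTracesSpectral
import Summits.QuantumFields.QCD.Theorems.QuarksAsStableActionStableActionBridgeStubVacuumEven
import Summits.QuantumFields.QCD.Theorems.QuarksAsStableActionStableActionBridgeTransferPositivity
import Summits.QuantumFields.QCD.Theorems.QuarksAsStableActionStableActionBridgeTransferLevelBounds
import Summits.QuantumFields.QCD.Theorems.QuarksAsStableActionStableActionBridgeStubCyclicPeelC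
import Summits.QuantumFields.QCD.Theorems.QuarksAsStableActionStableActionBridgeStubSpectralTraceC
import Summits.QuantumFields.QCD.Theorems.QuarksAsStableActionStableActionBridgeStubFermionSliceOpSqrt
import Summits.QuantumFields.QCD.Theorems.QuarksAsStableActionStableActionBridgeStubScalarKernelProps
import Summits.QuantumFields.QCD.Theorems.QuarksAsStableActionStableActionBridgeStubCyclicScalariseSlices
import Summits.QuantumFields.QCD.Theorems.QuarksAsStableActionStableActionBridgeStubJointEigenbasisInvolution
import Summits.QuantumFields.QCD.Theorems.QuarksAsStableActionStableActionBridgeStubMulInvolutionOp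
import Summits.QuantumFields.QCD.Theorems.QuarksAsStableActionStableActionBridgeStubExistsTopIndex
import Summits.QuantumFields.QCD.Theorems.QuarksAsStableActionStableActionBridgeStubLevelZeroEqEigenmax
import Literature.Analysis.OperatorTheory.HermitianKernelOperator
import Literature.Analysis.OperatorTheory.IntegralOperatorHilbertSchmidt
import Literature.Analysis.OperatorTheory.JointEigenbasis
import Mathlib.MeasureTheory.Measure.SeparableMeasure
import HarnessLib

/-!
# Spectral representation of the thermal and twisted traces at every extent, with an EVEN vacuum
(stub `stub_thermalTraces_spectral_even` of line `twisted_trace_transfer`, crux `QuarksAsStableAction.StableActionBridge`,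
stmt-QuantumFields-9737; lead assembly D″ = D′ + the vacuum-parity clause Q2, cycle 18)

Same eigen-data as `stub_thermalTraces_spectral` (levels `0 ≤ λᵢ ≤ λ_{i₀} = qcdTransferLevel … 0`, parities `σᵢ = ±1`, all-extent
thermal / twisted traces `Σ λᵢ^{m+2}` / `Σ σᵢ λᵢ^{m+2}`), PLUS: if the top level is simple among the `λᵢ` (which the trace-level
pressure clause delivers for large extents, `stub_simple_of_trace_lt`) then the vacuum is fermion-EVEN, `σ_{i₀} = 1`
(`stub_vacuum_even`: charge conjugation × mode-number sectors).  With `stub_denominator_comparison` this is everything the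
DENOMINATOR part of the returns needs.  References: Lüscher 1977; Reed–Simon I Thm VI.16, VI.22–23; Lucini et al. 2016 App. D.
-/

noncomputable section

namespace Summit.QuantumFields.QCD.Cruxes.StableActionBridge.TwistedTraceTransfer

open MeasureTheory Filter
open scoped InnerProductSpace ComplexConjugate Matrix BigOperators ENNReal
open Literature.MathematicalPhysics.QuantumFieldTheory Literature.MathematicalPhysics.QuantumLattice
open Literature.Probability.LatticeModels (TorusSite)
open Literature.Analysis.OperatorTheory



open StubTorusDenominatorsSpectral in
/-- **Sub-goal D″ (registered stub `stub_thermalTraces_spectral_even`; lead): the spectral representation at EVERY extent with an EVEN vacuum under simplicity.**  For `β ≥ 0`,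
all `m_f > −1` and every spatial torus of side `S`, ONE countable family of levels `0 ≤ λᵢ ≤ λ_{i₀} = qcdTransferLevel N_f S β m 0`,
`0 < λ_{i₀}`, `Σ λᵢ² < ∞`, with parities `σᵢ = ±1`, represents the thermal trace `Θ_{m+2} = Σᵢ λᵢ^{m+2}` AND the twisted (supertrace)
one `= Σᵢ σᵢ λᵢ^{m+2}` for ALL `m` simultaneously (the eigen-data of Lüscher's transfer operator on the side-`S` torus).  This is what the
trace-level pressure clause and the returns consume. [cite: Luscher1977, pp. 283–292] [cite: ReedSimonI1980, Thm. VI.16 and VI.22–23] -/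
theorem stub_thermalTraces_spectral_even : ∀ (Nf S : ℕ) [NeZero S] (β : ℝ) (mq : Fin Nf → ℝ),
    0 ≤ β → (∀ f, -1 < mq f) →
    ∃ (ι : Type) (_ : Countable ι) (lam σ : ι → ℝ) (i₀ : ι),
      (∀ i, 0 ≤ lam i ∧ lam i ≤ lam i₀) ∧ (∀ i, σ i = 1 ∨ σ i = -1) ∧ 0 < lam i₀ ∧
      lam i₀ = qcdTransferLevel Nf S β mq 0 ∧ Summable (fun i => lam i ^ 2) ∧
      ((∀ i, lam i = lam i₀ → i = i₀) → σ i₀ = 1) ∧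
      ∀ m : ℕ,
        HasSum (fun i => (lam i : ℂ) ^ (m + 2))
          (∫ p : (Fin (m + 2) → GaugeConfig 3 S (Matrix.specialUnitaryGroup (Fin 3) ℂ)) × (Fin (m + 2) → TorusSite 3 S → (Matrix.specialUnitaryGroup (Fin 3) ℂ)),
            ((∏ t : Fin (m + 2), gaugeSliceKernel β (p.1 t) (gaugeTransform (p.2 t) (p.1 (t + 1))) : ℝ) : ℂ) *
              ((List.ofFn fun t : Fin (m + 2) => fermionSliceOp (p.1 t) mq * @fockGaugeAct Nf S _ (p.2 t)).prod).trace
            ∂((Measure.pi fun _ : Fin (m + 2) => sliceHaar S).prod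
                (Measure.pi fun _ : Fin (m + 2) => Measure.pi fun _ : TorusSite 3 S => haarProbability (Matrix.specialUnitaryGroup (Fin 3) ℂ)))) ∧
        HasSum (fun i => (σ i : ℂ) * (lam i : ℂ) ^ (m + 2))
          (∫ p : (Fin (m + 2) → GaugeConfig 3 S (Matrix.specialUnitaryGroup (Fin 3) ℂ)) × (Fin (m + 2) → TorusSite 3 S → (Matrix.specialUnitaryGroup (Fin 3) ℂ)),
            ((∏ t : Fin (m + 2), gaugeSliceKernel β (p.1 t) (gaugeTransform (p.2 t) (p.1 (t + 1))) : ℝ) : ℂ) *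
              ∑ s : Finset (SliceFermiIdx Nf S), (-1 : ℂ) ^ s.card *
                ((List.ofFn fun t : Fin (m + 2) => fermionSliceOp (p.1 t) mq * @fockGaugeAct Nf S _ (p.2 t)).prod) s s
            ∂((Measure.pi fun _ : Fin (m + 2) => sliceHaar S).prod
                (Measure.pi fun _ : Fin (m + 2) => Measure.pi fun _ : TorusSite 3 S => haarProbability (Matrix.specialUnitaryGroup (Fin 3) ℂ)))) := by
  intro Nf S _ β mq hβ hm
  set X := GaugeConfig 3 S (Matrix.specialUnitaryGroup (Fin 3) ℂ) with hXdef
  set Fι := Finset (SliceFermiIdx Nf S) with hFdef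
  set ρ : Measure (X × Fι) := (sliceHaar S).prod (Measure.count : Measure Fι) with hρ
  haveI : SecondCountableTopology (Matrix (Fin 3) (Fin 3) ℂ) := inferInstance
  haveI : SecondCountableTopology (Matrix.specialUnitaryGroup (Fin 3) ℂ) :=
    Topology.IsEmbedding.subtypeVal.secondCountableTopology
  haveI hprob : IsProbabilityMeasure (sliceHaar (S := S)) := Sketch.isProbabilityMeasure_sliceHaar S
  haveI : IsFiniteMeasure ρ := by rw [hρ]; infer_instance
  haveI : MeasureTheory.IsSeparable ρ := by rw [hρ]; infer_instance
  haveI : Fact ((2 : ℝ≥0∞) ≠ ⊤) := ⟨ENNReal.ofNat_ne_top⟩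
  obtain ⟨R, hRc, hR⟩ := stub_fermionSliceOp_sqrt Nf S mq hm
  have hR2 : ∀ U, (R U)ᴴ = R U ∧ R U * R U = fermionSliceOp U mq := fun U => ⟨(hR U).1, (hR U).2.1⟩
  set k : X × Fι → X × Fι → ℂ := fun y y' => (R y.1 * (Matrix.of fun a c =>
      ∫ g : TorusSite 3 S → Matrix.specialUnitaryGroup (Fin 3) ℂ,
      (gaugeSliceKernel β y.1 (gaugeTransform g y'.1) : ℂ) * @fockGaugeAct Nf S _ g a c
        ∂(Measure.pi fun _ => haarProbability (Matrix.specialUnitaryGroup (Fin 3) ℂ))) * R y'.1) y.2 y'.2 with hk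
  obtain ⟨-, hkm, ⟨C, hkC⟩, hkh, hkpar⟩ := stub_scalarKernel_props Nf S β mq hm R hRc hR k (fun _ _ => rfl)
  obtain ⟨A, hA, hsa, hcpt, -⟩ := exists_hermitianKernelOp ρ k C hkm hkC hkh
  set w : X × Fι → ℝ := fun y => (-1 : ℝ) ^ y.2.card with hw
  have hwm : Measurable w := by
    refine Measurable.comp (g := fun s : Fι => (-1 : ℝ) ^ s.card) (measurable_of_countable _) measurable_snd
  have hw1 : ∀ y, w y = 1 ∨ w y = -1 := fun y => by
    rcases neg_one_pow_eq_or ℝ y.2.card with h | h <;> simp [hw, h]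
  have hwc : ∀ y, ((w y : ℝ) : ℂ) = (-1 : ℂ) ^ y.2.card := fun y => by simp [hw]
  obtain ⟨F, hF, hFsa, hFF, hFcomm, hFinner⟩ := stub_mulInvolutionOp (X × Fι) ρ w hwm hw1
  have hinter : ∀ x y, k x y * (w y : ℂ) = (w x : ℂ) * k x y := by
    intro x y
    by_cases hxy : (-1 : ℂ) ^ x.2.card = (-1 : ℂ) ^ y.2.card
    · rw [hwc, hwc, hxy, mul_comm]
    · rw [hkpar x y hxy, zero_mul, mul_zero]
  have hAF : A * F = F * A := hFcomm k C hkm hkC hinter A hA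
  obtain ⟨ι, b, lam, σ, hb, hFb, hσ⟩ :=
    stub_jointEigenbasis_involution (Lp ℂ 2 ρ) A F hsa hcpt hFsa hFF hAF
  have hinj : Function.Injective (b : ι → Lp ℂ 2 ρ) := b.orthonormal.linearIndependent.injective
  haveI hcnt : Countable ι := by
    have hon : Orthonormal ℂ ((↑) : Set.range (b : ι → Lp ℂ 2 ρ) → Lp ℂ 2 ρ) :=
      (orthonormal_subtype_range hinj).2 b.orthonormal
    haveI := (hon.countable_of_separableSpace (𝕜 := ℂ)).to_subtype
    have hinj' : Function.Injective (fun i : ι => (⟨b i, i, rfl⟩ : Set.range (b : ι → Lp ℂ 2 ρ))) :=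
      fun i j h => hinj (congrArg Subtype.val h)
    exact hinj'.countable
  obtain ⟨hbound, hleast⟩ := stub_levelZero_eq_eigenmax Nf S β mq hβ hm R hRc hR2 k (fun _ _ => rfl) A hsa hA ι b lam hb
  have hone : ∀ i, ∫ y, ((‖(b i : X × Fι → ℂ) y‖ ^ 2 : ℝ) : ℂ) ∂ρ = 1 :=
    fun i => integral_norm_sq_eq_one (b i) (b.orthonormal.norm_eq_one i)
  have hS2 : Summable fun i => lam i ^ 2 := by
    have h := stub_spectralTraceC (X × Fι) ρ k C hkm hkC hkh A hA ι b lam hb (fun _ => (1 : ℂ)) 1 measurable_const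
      (fun _ => by simp) 0
    have hfun : (fun i => (lam i : ℂ) ^ (0 + 2) * ∫ x, (1 : ℂ) * ((‖(b i : X × Fι → ℂ) x‖ ^ 2 : ℝ) : ℂ) ∂ρ) =
        fun i => ((lam i ^ 2 : ℝ) : ℂ) := by
      funext i
      have h1 : ∫ x, (1 : ℂ) * ((‖(b i : X × Fι → ℂ) x‖ ^ 2 : ℝ) : ℂ) ∂ρ = 1 := by
        simp only [one_mul]; exact hone i
      rw [h1, mul_one, Complex.ofReal_pow]
    rw [hfun] at h
    exact Complex.summable_ofReal.1 h.summable
  set s := qcdTransferLevel Nf S β mq 0 with hs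
  have hs0 : 0 < s := Sketch.TransferLevelBounds.qcdTransferLevel_zero_pos hβ hm
  obtain ⟨i₀, hi₀⟩ := stub_exists_top_index ι lam s hs0 hS2 (fun i => (hbound i).2) hleast
  have hP : ∀ U, Matrix.diagonal (fun s : Fι => (-1 : ℂ) ^ s.card) * R U =
      R U * Matrix.diagonal (fun s : Fι => (-1 : ℂ) ^ s.card) :=
    fun U => (hR U).2.2 _ (StubScalarKernelProps.parity_comm_fermionSliceOp U mq)
  -- the all-extent pieces
  set κ : (X × Fι → ℂ) → X × Fι → ℂ := fun f x => ∫ z, k x z * f z ∂ρ with hκ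
  have hkmeas : Measurable (Function.uncurry k) := hkm.measurable
  have hwb : ∀ y, ‖((w y : ℝ) : ℂ)‖ ≤ 1 := fun y => by
    rcases hw1 y with h | h <;> simp [h]
  have hwmC : Measurable fun y : X × Fι => ((w y : ℝ) : ℂ) := Complex.measurable_ofReal.comp hwm
  have hl0 : lam i₀ ≠ 0 := by rw [hi₀]; exact hs0.ne'
  have heven : (∀ i, lam i = lam i₀ → i = i₀) → σ i₀ = 1 := fun hsimp =>
    stub_vacuum_even Nf S β mq hm R hRc hR k (fun _ _ => rfl) A hsa hA F hF ι b lam σ hb hFb i₀ hl0 hsimp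
  refine ⟨ι, hcnt, lam, σ, i₀, fun i => ⟨(hbound i).1, hi₀ ▸ (hbound i).2⟩, hσ, hi₀ ▸ hs0, hi₀, hS2, heven, fun M => ?_⟩
  obtain ⟨hAP, hPer⟩ := stub_cyclic_scalarise_slices Nf S β mq M R hRc (fun U => (hR U).2.1) hP
  have hiter : ∀ (x : X × Fι),
      (κ^[0 + 1]) (fun y => (1 : ℂ) * (κ^[M]) (fun z => k z x) y) x = (κ^[M + 1]) (fun z => k z x) x := by
    intro x
    have e : (fun y => (1 : ℂ) * (κ^[M]) (fun z => k z x) y) = (κ^[M]) (fun z => k z x) := funext fun y => one_mul _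
    rw [e, zero_add, Function.iterate_one, ← Function.iterate_succ_apply' κ M]
  have hpeel1 : ∫ V : Fin (M + 2) → X × Fι, ∏ t, k (V t) (V (t + 1)) ∂(Measure.pi fun _ => ρ) =
      ∫ x, (κ^[M + 1]) (fun z => k z x) x ∂ρ := by
    have h := stub_cyclicPeelC (X × Fι) ρ k C hkmeas hkC M 0 (fun _ => (1 : ℂ)) (fun _ => (1 : ℂ)) 1 1
      measurable_const measurable_const (fun _ => by simp) (fun _ => by simp) ⟨1, by omega⟩ rfl
    have h' : ∫ V : Fin (M + 2) → X × Fι, (1 : ℂ) * 1 * ∏ t, k (V t) (V (t + 1)) ∂(Measure.pi fun _ => ρ) =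
        ∫ x, (1 : ℂ) * (κ^[0 + 1]) (fun y => (1 : ℂ) * (κ^[M]) (fun z => k z x) y) x ∂ρ := h
    have hl : (fun V : Fin (M + 2) → X × Fι => (1 : ℂ) * 1 * ∏ t, k (V t) (V (t + 1))) =
        fun V => ∏ t, k (V t) (V (t + 1)) := funext fun V => by rw [one_mul, one_mul]
    rw [hl] at h'
    refine h'.trans (integral_congr_ae (Eventually.of_forall fun x => ?_))
    dsimp only
    rw [one_mul, hiter x]
  have hpeelw : ∫ V : Fin (M + 2) → X × Fι, (-1 : ℂ) ^ (V 0).2.card * ∏ t, k (V t) (V (t + 1))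
        ∂(Measure.pi fun _ => ρ) = ∫ x, ((w x : ℝ) : ℂ) * (κ^[M + 1]) (fun z => k z x) x ∂ρ := by
    have h := stub_cyclicPeelC (X × Fι) ρ k C hkmeas hkC M 0 (fun y => ((w y : ℝ) : ℂ)) (fun _ => (1 : ℂ)) 1 1
      hwmC measurable_const hwb (fun _ => by simp) ⟨1, by omega⟩ rfl
    have h' : ∫ V : Fin (M + 2) → X × Fι, ((w (V 0) : ℝ) : ℂ) * 1 * ∏ t, k (V t) (V (t + 1))
          ∂(Measure.pi fun _ => ρ) =
        ∫ x, ((w x : ℝ) : ℂ) * (κ^[0 + 1]) (fun y => (1 : ℂ) * (κ^[M]) (fun z => k z x) y) x ∂ρ := h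
    have hl : (fun V : Fin (M + 2) → X × Fι => ((w (V 0) : ℝ) : ℂ) * 1 * ∏ t, k (V t) (V (t + 1))) =
        fun V => (-1 : ℂ) ^ (V 0).2.card * ∏ t, k (V t) (V (t + 1)) := funext fun V => by rw [mul_one, hwc]
    rw [hl] at h'
    refine h'.trans (integral_congr_ae (Eventually.of_forall fun x => ?_))
    dsimp only
    rw [hiter x]
  have htr1 := stub_spectralTraceC (X × Fι) ρ k C hkm hkC hkh A hA ι b lam hb (fun _ => (1 : ℂ)) 1 measurable_const
    (fun _ => by simp) M
  have htrw := stub_spectralTraceC (X × Fι) ρ k C hkm hkC hkh A hA ι b lam hb (fun y => ((w y : ℝ) : ℂ)) 1 hwmC hwb M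
  simp only [one_mul] at htr1
  refine ⟨?_, ?_⟩
  · rw [hAP, hpeel1]
    have hterm : (fun i => (lam i : ℂ) ^ (M + 2)) =
        fun i => (lam i : ℂ) ^ (M + 2) * ∫ x, ((‖(b i : X × Fι → ℂ) x‖ ^ 2 : ℝ) : ℂ) ∂ρ :=
      funext fun i => by rw [hone i, mul_one]
    rw [hterm]
    exact htr1
  · rw [hPer, hpeelw]
    have hterm : (fun i => (σ i : ℂ) * (lam i : ℂ) ^ (M + 2)) =
        fun i => (lam i : ℂ) ^ (M + 2) * ∫ x, ((w x : ℝ) : ℂ) * ((‖(b i : X × Fι → ℂ) x‖ ^ 2 : ℝ) : ℂ) ∂ρ := by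
      funext i
      rw [← hFinner (b i), hFb i, inner_smul_right, inner_self_eq_norm_sq_to_K, b.orthonormal.norm_eq_one i]
      push_cast
      ring
    rw [hterm]
    exact htrw

end Summit.QuantumFields.QCD.Cruxes.StableActionBridge.TwistedTraceTransfer

end
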